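import Literature.Geometry.Riemannian.EuclideanHypersurfaceContact
import HarnessLib

/-!
# Mean curvature of immersions of a vector space and of graphs via second derivatives

Topic `Literature/Geometry/Riemannian`.  For a smooth immersion `f : E' → W` of a finite-dimensional
real normed space INTO a Euclidean space (the parameter manifold being the model vector space
itself, so that chart-straight curves are straight lines `y + t u`) and a smooth field `ν` normal
to `f`, the tree's mean curvature (`H = tr_{f^*δ} K_ν`, `K_ν(v, w) = ⟪dν v, df w⟫`,
`Lorentzian/Hypersurface.lean`) is

  `H(y) = -⟪ν y, ∑ᵢ D²f(y)(bᵢ, bᵢ)⟫`     (`meanCurvature_eq_neg_inner_sum_iteratedFDeriv`)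

for every `f^*δ`-orthonormal basis `b` of `E'` — the normal component of the coordinate expression
`g^{jk} ∂²_{jk} f` of the mean curvature vector.  For a GRAPH `f = ι + u` with `ι` linear,
`D²f = D²u` (`iteratedFDeriv_two_linear_add`), so `H(y) = -⟪ν y, ∑ᵢ D²u(y)(bᵢ, bᵢ)⟫`
(`meanCurvature_graph_eq`): the scalar mean curvatures of a graph w.r.t. its unit normals are the
normal components of the vertical vector `-∑ᵢ D²u(bᵢ, bᵢ)`, the starting point of the
nonparametric mean curvature flow system (White 2005, §8.4).  In codimension two the normal part
of `∑ᵢ D²f(bᵢ, bᵢ)` is the mean curvature vector `-H₁ν₁ - H₂ν₂`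
(`starProjection_sum_iteratedFDeriv_eq_meanCurvatureVector`, with the projection formula
`starProjection_orthogonal_eq_of_codimTwo`).

Everything is PROVED; no definitions, no named facts.

## References

* C. Mantegazza, *Lecture Notes on Mean Curvature Flow*, Birkhäuser 2011, §1.1. [Mantegazza2011]
* B. White, *A local regularity theorem for mean curvature flow*, Ann. of Math. 161 (2005), §8.4.
  [White2005]
-/

noncomputable section

open Bundle Set Function Module Filter
open scoped Manifold ContDiff Topology RealInnerProductSpace

namespace Literature.Geometry.Riemannian

open Lorentzian Lorentzian.PseudoRiemannianMetric EuclideanHypersurface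

variable {E' : Type*} [NormedAddCommGroup E'] [NormedSpace ℝ E']
  {W : Type*} [NormedAddCommGroup W] [InnerProductSpace ℝ W]

/-- On the model vector space the chart-straight curve is the straight line `t ↦ y + t u`.
[folklore] -/
theorem curveThrough_model_eq (y u : E') : curveThrough 𝓘(ℝ, E') y u = fun t => y + t • u := by
  funext t
  simp [curveThrough]

/-- Second derivative of a `C²` map along a straight line: `(f(y + t u))''(0) = D²f(y)(u, u)`.
[folklore] -/
theorem deriv_deriv_comp_line_eq_iteratedFDeriv {f : E' → W} (hf : ContDiff ℝ 2 f) (y u : E') :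
    deriv (deriv (f ∘ fun t : ℝ => y + t • u)) 0 = iteratedFDeriv ℝ 2 f y ![u, u] := by
  set ℓ : ℝ → E' := fun t => y + t • u with hℓ
  have hℓd : ∀ t, HasDerivAt ℓ u t := fun t => by
    have := ((hasDerivAt_id t).smul_const u).const_add y
    simpa [hℓ] using this
  have hℓ0 : ℓ 0 = y := by simp [hℓ]
  have hfd : Differentiable ℝ f := hf.differentiable (by norm_num)
  have hder : deriv (f ∘ ℓ) = fun t => fderiv ℝ f (ℓ t) u := by
    funext t
    exact ((hfd (ℓ t)).hasFDerivAt.comp_hasDerivAt t (hℓd t)).deriv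
  rw [hder]
  have hf1 : Differentiable ℝ (fderiv ℝ f) :=
    (hf.fderiv_right (m := 1) (by norm_num)).differentiable (by norm_num)
  have hL : HasDerivAt (fun t => fderiv ℝ f (ℓ t)) (fderiv ℝ (fderiv ℝ f) (ℓ 0) u) 0 :=
    (hf1 (ℓ 0)).hasFDerivAt.comp_hasDerivAt (0 : ℝ) (hℓd 0)
  have hLu : HasDerivAt (fun t => fderiv ℝ f (ℓ t) u) (fderiv ℝ (fderiv ℝ f) (ℓ 0) u u) 0 := by
    have := hL.clm_apply (hasDerivAt_const (0 : ℝ) u)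
    simpa using this
  rw [hLu.deriv, hℓ0, iteratedFDeriv_two_apply]
  rfl

/-- For a graph-type map `f = ι + u` with `ι` continuous linear, `D²f = D²u`. [folklore] -/
theorem iteratedFDeriv_two_linear_add (ι : E' →L[ℝ] W) {u : E' → W} (hu : ContDiff ℝ 2 u)
    (y : E') (m : Fin 2 → E') :
    iteratedFDeriv ℝ 2 (fun x => ι x + u x) y m = iteratedFDeriv ℝ 2 u y m := by
  have h1 : iteratedFDeriv ℝ 2 (fun x => ι x + u x) y =
      iteratedFDeriv ℝ 2 (fun x => ι x) y + iteratedFDeriv ℝ 2 u y :=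
    iteratedFDeriv_add_apply (ι.contDiff.of_le le_top).contDiffAt hu.contDiffAt
  have h2 : iteratedFDeriv ℝ 2 (fun x => ι x) y m = 0 := by
    rw [iteratedFDeriv_two_apply]
    have : fderiv ℝ (fun x => ι x) = fun _ => ι := by
      funext x; exact ι.fderiv
    rw [this, fderiv_const_apply]
    rfl
  rw [h1, add_apply, h2, zero_add]

/-- `2 ≤ ∞` in `ℕ∞ω`. [folklore] -/
private theorem two_le_infty : ((2 : ℕ) : ℕ∞ω) ≤ ∞ := WithTop.coe_le_coe.mpr le_top

variable [FiniteDimensional ℝ E'] [FiniteDimensional ℝ W] [(euclideanMetric W).HasLeviCivita]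

/-- **Mean curvature of an immersion of a vector space via second derivatives**: for a smooth
immersion `f : E' → W` (parameter manifold the model space `E'` itself), a smooth field `ν`
normal to `f` and an `f^*δ`-orthonormal basis `b` of `E'`,
`H(y) = -⟪ν y, ∑ᵢ D²f(y)(bᵢ, bᵢ)⟫`. [cite: Mantegazza2011, §1.1] -/
theorem meanCurvature_eq_neg_inner_sum_iteratedFDeriv {f ν : E' → W}
    (hpb : contMDiff_pullbackBilin 𝓘(ℝ, W) W 𝓘(ℝ, E') E' ∞)
    (hf : (euclideanMetric W).IsSpacelikeImmersion 𝓘(ℝ, E') f) (hf2 : ContDiff ℝ 2 f)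
    (hν : ContMDiff 𝓘(ℝ, E') 𝓘(ℝ, W) ∞ ν) (hn : (euclideanMetric W).IsNormalTo 𝓘(ℝ, E') f ν)
    {y : E'} {ι : Type*} [Fintype ι] (b : Module.Basis ι ℝ (TangentSpace 𝓘(ℝ, E') y))
    (hb : ((euclideanMetric W).inducedMetric f hpb hf).IsOrthonormalFrame y b) :
    (euclideanMetric W).meanCurvature f hpb hf ν y =
      -⟪ν y, ∑ i, iteratedFDeriv ℝ 2 f y ![b i, b i]⟫ := by
  rw [meanCurvature_eq_neg_inner_sum hpb hf hν hn b hb]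
  congr 2
  refine Finset.sum_congr rfl fun i _ => ?_
  rw [curveThrough_model_eq]
  exact deriv_deriv_comp_line_eq_iteratedFDeriv hf2 y (b i)

/-- **Mean curvature of a graph**: for `f = ι + u` (`ι` continuous linear, `u` smooth) and `ν`,
`b` as above, `H(y) = -⟪ν y, ∑ᵢ D²u(y)(bᵢ, bᵢ)⟫`. [cite: White2005, §8.4]
[cite: Mantegazza2011, §1.1] -/
theorem meanCurvature_graph_eq (ι' : E' →L[ℝ] W) {u ν : E' → W}
    (hpb : contMDiff_pullbackBilin 𝓘(ℝ, W) W 𝓘(ℝ, E') E' ∞)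
    (hf : (euclideanMetric W).IsSpacelikeImmersion 𝓘(ℝ, E') (fun x => ι' x + u x))
    (hu : ContDiff ℝ ∞ u)
    (hν : ContMDiff 𝓘(ℝ, E') 𝓘(ℝ, W) ∞ ν)
    (hn : (euclideanMetric W).IsNormalTo 𝓘(ℝ, E') (fun x => ι' x + u x) ν)
    {y : E'} {ι : Type*} [Fintype ι] (b : Module.Basis ι ℝ (TangentSpace 𝓘(ℝ, E') y))
    (hb : ((euclideanMetric W).inducedMetric (fun x => ι' x + u x) hpb hf).IsOrthonormalFrame y b) :
    (euclideanMetric W).meanCurvature (fun x => ι' x + u x) hpb hf ν y =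
      -⟪ν y, ∑ i, iteratedFDeriv ℝ 2 u y ![b i, b i]⟫ := by
  have hf2 : ContDiff ℝ 2 (fun x => ι' x + u x) :=
    (ι'.contDiff.add hu).of_le (by exact_mod_cast two_le_infty)
  rw [meanCurvature_eq_neg_inner_sum_iteratedFDeriv hpb hf hf2 hν hn b hb]
  congr 2
  refine Finset.sum_congr rfl fun i _ => ?_
  exact iteratedFDeriv_two_linear_add ι' (hu.of_le (by exact_mod_cast two_le_infty)) y _

/-! ### Codimension two: the normal part of `∑ᵢ D²f(bᵢ, bᵢ)` is the mean curvature vector -/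

omit [FiniteDimensional ℝ E'] [(euclideanMetric W).HasLeviCivita] in
/-- **Orthogonal projection onto a plane spanned by two orthonormal vectors**: if `ν₁, ν₂` are
orthonormal, both orthogonal to a subspace `T`, and `dim W = dim T + 2`, then
`P_{Tᗮ} w = ⟪w, ν₁⟫ ν₁ + ⟪w, ν₂⟫ ν₂`. [folklore] -/
theorem starProjection_orthogonal_eq_of_codimTwo (T : Submodule ℝ W) {ν₁ ν₂ : W}
    (h₁ : ‖ν₁‖ = 1) (h₂ : ‖ν₂‖ = 1) (h₁₂ : ⟪ν₁, ν₂⟫ = 0)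
    (hT₁ : ν₁ ∈ Tᗮ) (hT₂ : ν₂ ∈ Tᗮ) (hdim : finrank ℝ W = finrank ℝ T + 2) (w : W) :
    Tᗮ.starProjection w = ⟪w, ν₁⟫ • ν₁ + ⟪w, ν₂⟫ • ν₂ := by
  -- `ν = ![ν₁, ν₂]` is an orthonormal family in `Tᗮ` spanning it (dimension count)
  set v : Fin 2 → W := ![ν₁, ν₂] with hv
  have hon : Orthonormal ℝ v := by
    rw [orthonormal_iff_ite]
    intro i j
    fin_cases i <;> fin_cases j
    · simp [hv, h₁]
    · simp [hv, h₁₂]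
    · simp [hv, real_inner_comm, h₁₂]
    · simp [hv, h₂]
  have hrange : Set.range v = {ν₁, ν₂} := by
    ext x
    simp only [Set.mem_range, Set.mem_insert_iff, Set.mem_singleton_iff, Fin.exists_fin_two, hv,
      Matrix.cons_val_zero, Matrix.cons_val_one]
    constructor
    · rintro (h | h) <;> [exact Or.inl h.symm; exact Or.inr h.symm]
    · rintro (h | h) <;> [exact Or.inl h.symm; exact Or.inr h.symm]
  have hTdim : finrank ℝ Tᗮ = 2 := by
    have := T.finrank_add_finrank_orthogonal
    omega
  have hspan : Submodule.span ℝ ({ν₁, ν₂} : Set W) = Tᗮ := by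
    apply Submodule.eq_of_le_of_finrank_eq
    · rw [Submodule.span_le]
      intro x hx
      rcases hx with rfl | rfl
      · exact hT₁
      · exact hT₂
    · rw [hTdim, ← hrange, finrank_span_eq_card hon.linearIndependent]
      simp
  -- the candidate projection
  set q : W := ⟪w, ν₁⟫ • ν₁ + ⟪w, ν₂⟫ • ν₂ with hq
  have hqmem : q ∈ Tᗮ := Tᗮ.add_mem (Tᗮ.smul_mem _ hT₁) (Tᗮ.smul_mem _ hT₂)
  have h₂₁ : ⟪ν₂, ν₁⟫ = 0 := by rw [real_inner_comm]; exact h₁₂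
  have hs₁ : ⟪ν₁, ν₁⟫ = 1 := by rw [real_inner_self_eq_norm_sq, h₁]; norm_num
  have hs₂ : ⟪ν₂, ν₂⟫ = 1 := by rw [real_inner_self_eq_norm_sq, h₂]; norm_num
  have ho₁ : ⟪w - q, ν₁⟫ = 0 := by
    rw [hq, inner_sub_left, inner_add_left, real_inner_smul_left, real_inner_smul_left, hs₁, h₂₁]
    ring
  have ho₂ : ⟪w - q, ν₂⟫ = 0 := by
    rw [hq, inner_sub_left, inner_add_left, real_inner_smul_left, real_inner_smul_left, h₁₂, hs₂]
    ring
  refine Submodule.eq_starProjection_of_mem_of_inner_eq_zero hqmem fun z hz => ?_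
  rw [← hspan, Submodule.mem_span_pair] at hz
  obtain ⟨c, d, rfl⟩ := hz
  rw [inner_add_right, real_inner_smul_right, real_inner_smul_right, ho₁, ho₂]
  ring

/-- **The normal part of `∑ᵢ D²f(bᵢ, bᵢ)` is the mean curvature vector `-H₁ν₁ - H₂ν₂`**
(codimension two): for a smooth immersion `f : E' → W` with `dim W = dim E' + 2`, orthonormal
smooth normal fields `ν₁, ν₂` and an `f^*δ`-orthonormal basis `b` of `T_y E'`,
`P_{(df_y E')ᗮ} (∑ᵢ D²f(y)(bᵢ, bᵢ)) = -H₁(y) ν₁(y) - H₂(y) ν₂(y)`.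
[cite: White2005, §8.4] [cite: Mantegazza2011, §1.1] -/
theorem starProjection_sum_iteratedFDeriv_eq_meanCurvatureVector {f ν₁ ν₂ : E' → W}
    (hpb : contMDiff_pullbackBilin 𝓘(ℝ, W) W 𝓘(ℝ, E') E' ∞)
    (hf : (euclideanMetric W).IsSpacelikeImmersion 𝓘(ℝ, E') f) (hf2 : ContDiff ℝ 2 f)
    (hν₁ : ContMDiff 𝓘(ℝ, E') 𝓘(ℝ, W) ∞ ν₁) (hν₂ : ContMDiff 𝓘(ℝ, E') 𝓘(ℝ, W) ∞ ν₂)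
    (hn₁ : (euclideanMetric W).IsUnitNormal 𝓘(ℝ, E') f ν₁ 1)
    (hn₂ : (euclideanMetric W).IsUnitNormal 𝓘(ℝ, E') f ν₂ 1)
    (h₁₂ : ∀ y, ⟪ν₁ y, ν₂ y⟫ = 0) (hdim : finrank ℝ W = finrank ℝ E' + 2)
    {y : E'} {ι : Type*} [Fintype ι] (b : Module.Basis ι ℝ (TangentSpace 𝓘(ℝ, E') y))
    (hb : ((euclideanMetric W).inducedMetric f hpb hf).IsOrthonormalFrame y b) :
    (LinearMap.range (mvfderiv 𝓘(ℝ, E') f y).toLinearMap)ᗮ.starProjection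
        (∑ i, iteratedFDeriv ℝ 2 f y ![b i, b i]) =
      -((euclideanMetric W).meanCurvature f hpb hf ν₁ y) • ν₁ y
        - ((euclideanMetric W).meanCurvature f hpb hf ν₂ y) • ν₂ y := by
  set A : TangentSpace 𝓘(ℝ, E') y →L[ℝ] W := mvfderiv 𝓘(ℝ, E') f y with hA
  set T : Submodule ℝ W := LinearMap.range A.toLinearMap with hT
  -- unit normals: norms, orthogonality to `T`
  have hun : ∀ {ν : E' → W}, (euclideanMetric W).IsUnitNormal 𝓘(ℝ, E') f ν 1 → ‖ν y‖ = 1 := by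
    intro ν hn
    have h : ⟪ν y, ν y⟫ = (1 : ℝ) := by
      have := hn.val_self y
      rwa [euclideanMetric_apply] at this
    have h2 : ‖ν y‖ ^ 2 = 1 := by simpa [real_inner_self_eq_norm_sq] using h
    nlinarith [norm_nonneg (ν y), sq_nonneg (‖ν y‖ - 1)]
  have hun₁ : ‖ν₁ y‖ = 1 := hun hn₁
  have hun₂ : ‖ν₂ y‖ = 1 := hun hn₂
  have hT₁ : ν₁ y ∈ Tᗮ := by
    rw [Submodule.mem_orthogonal]
    rintro _ ⟨v, rfl⟩
    have h := hn₁.isNormalTo y v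
    rw [euclideanMetric_apply] at h
    rw [real_inner_comm]; exact h
  have hT₂ : ν₂ y ∈ Tᗮ := by
    rw [Submodule.mem_orthogonal]
    rintro _ ⟨v, rfl⟩
    have h := hn₂.isNormalTo y v
    rw [euclideanMetric_apply] at h
    rw [real_inner_comm]; exact h
  -- `dim T = dim E'` (immersion)
  have hTdim : finrank ℝ T = finrank ℝ E' := by
    rw [hT, LinearMap.finrank_range_of_inj]
    · rfl
    · exact hf.injective_mfderiv y
  rw [starProjection_orthogonal_eq_of_codimTwo T hun₁ hun₂ (h₁₂ y) hT₁ hT₂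
      (by rw [hTdim]; exact hdim),
    meanCurvature_eq_neg_inner_sum_iteratedFDeriv hpb hf hf2 hν₁ hn₁.isNormalTo b hb,
    meanCurvature_eq_neg_inner_sum_iteratedFDeriv hpb hf hf2 hν₂ hn₂.isNormalTo b hb,
    real_inner_comm (ν₁ y), real_inner_comm (ν₂ y)]
  simp [neg_neg, sub_eq_add_neg, neg_smul]

end Literature.Geometry.Riemannian
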